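import Mathlib
import Literature.MathematicalPhysics.QuantumFieldTheory.Balaban1983to89.B12Average012Prop2

/-!
# `Balaban1983to89.B12Average012Locality` — [Balaban1987RG1] (0.12) / [Balaban1985Averaging] Prop. 4 (dependence
# clause): the `k`-fold (0.12)/(0.11) average `Ū^k(c)` depends on the configuration only through the bond variables
# `U(b)`, `b ⊂ B^k(c₋) ∪ B^k(c₊)` — PROVED for the b12 lineage's concrete average

HONEST FRAMING (cell `lit-balaban`, verbatim): statement-level skeleton of published theorems with citation tags;
proofs where landed; nothing here is a claim about the Yang–Mills mass gap.

CITATION HEADER.  T. Bałaban, *Renormalization group approach to lattice gauge field theories. I*, Commun. Math.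
Phys. **109** (1987) 249–301, doi:10.1007/bf01215223 [Balaban1987RG1] (cell paper B12 = «[I]»), (0.12) p. 254 and
«all results of the paper [12] are valid for it» (p. 254 [PDF 6], re-read from the held text
`paper:balaban1987-cmp109-rg-i-small-field`).  [12] = [B7] = [Balaban1985Averaging], Commun. Math. Phys. **98**
(1985) 17–51, Proposition 4 p. 38: «the function Q_k(U₀, ηA, c) = (1/i) log(Ū₁^k)_c, c ⊂ Ω^{(k)}, is an analytic
function of the variables A_b, b ⊂ B^k(c₋) ∪ B^k(c₊)» — the DEPENDENCE-DOMAIN clause only (tree leaf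
`B7.Prop4Printed`; index sets (140)–(141) p. 39 = the tree's `B7BlockGeometry.qppBonds`).  Unit `lit-balaban-r09`
gen 9 (display owner of CMP 109; TAKING line `HOME/STATUS.md` 2026-08-21T09:1xZ), HOME
`run/shared/lean/pub/lit-balaban/`; SKELETON row `B12.Eq0.12` (cell only).

DICTIONARY print → Lean (all PRE-EXISTING).  `Ū` ↦ `B12SmallFieldRegion255.avgBar`; `Ū^k` ↦
`B12Average012Prop2.avgIter012`; `{b ⊂ B^k(c₋) ∪ B^k(c₊)}` ↦ `B7BlockGeometry.qppBonds (L^k) c` (bonds with both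
endpoints in `twoBlocks (L^k) c`, corner cubes).

THE ARGUMENT FORMALISED.  One step: `B12AverageCorridor267.avgM_congr` for the block-local family (0.11)
(`B12ContourAverage253.isBlockLocal_Tavg`).  Induction: `Ū^{k+1}(c) = \overline{Ū^k}(c)` depends on `Ū^k(b)`,
`b ⊂ B(c₋) ∪ B(c₊)`, each of which depends on `U(b′)`, `b′ ⊂ B^k(b₋) ∪ B^k(b₊) ⊂ B^{k+1}(c₋) ∪ B^{k+1}(c₊)` (the
tree's nesting `B7BlockGeometry.qppBonds_subset_mul`).

WHAT IS PROVED (kernel-checked, no `sorry`, axioms `propext`, `Classical.choice`, `Quot.sound`; NO definition, NO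
`Prop` placeholder, net new unproved facts 0): `avgBar_congr`, `self_mem_qppBonds_one`, **`avgIter012_congr`**,
`avgIter012_eq_of_restrict_eq`.

DIVERGENCES FROM PRINT / WHAT IS NOT PROVED (honest scope).  (a) Only the dependence domain; the analyticity and
the expansion (134)–(135) of Proposition 4 are not touched (for the model average: `B7Prop4Flat`,
`B7Prop4GeneralLevels`).  (b) `ℤᵈ` corner cubes and the lineage's (0.10)–(0.12) (`B12ContourAverage253` (a)–(c));
with corner cubes the contours `Γ^π_{q,x}` stay inside `B(q)`, so no enlargement of the cubes is needed.
-/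

noncomputable section

open NormedSpace Finset

namespace Literature.MathematicalPhysics.QuantumFieldTheory.Balaban1983to89.B12Average012Locality

open Literature.MathematicalPhysics.QuantumLattice (ZdEdge blockMap blockSites mem_blockSites_iff blockMap_one)
open B7BlockGeometry (qppBonds mem_qppBonds twoBlocks mem_twoBlocks_iff qppBonds_subset_mul)
open B12AverageCorridor267 (avgM avgM_congr)
open B12ContourAverage253 (Tavg isBlockLocal_Tavg)
open B12SmallFieldRegion255 (avgBar)
open B12Average012Prop2 (avgIter012 avgIter012_zero avgIter012_succ)

variable {d : ℕ}
variable {𝔸 : Type*} [NormedRing 𝔸] [NormedAlgebra ℂ 𝔸] [CompleteSpace 𝔸] {L : ℕ}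

/-- [cite: Balaban1987RG1, (0.12) p.254][cite: Balaban1985Averaging, Prop.4 p.38] **THE AVERAGE (0.12) OVER THE
AVERAGED CONTOUR VARIABLES (0.11) IS LOCAL**: `Ū(c)` depends on the configuration only through the bond variables
`U(b)`, `b ⊂ B(c₋) ∪ B(c₊)` (the tree's `B12AverageCorridor267.avgM_congr` for the block-local family (0.11),
`B12ContourAverage253.isBlockLocal_Tavg`: every `Γ^π_{q,x} ⊂ B(q)`). -/
theorem avgBar_congr (hL : 0 < L) {U U' : ZdEdge d → 𝔸ˣ} {c : ZdEdge d}
    (hUU' : ∀ b ∈ qppBonds L c, U b = U' b) : avgBar L U c = avgBar L U' c :=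
  avgM_congr hL (isBlockLocal_Tavg hL) hUU'

omit [NormedAlgebra ℂ 𝔸] [CompleteSpace 𝔸] in
/-- [cite: Balaban1985Averaging, (140)–(141) p.39] at ratio `1` the index set `{b ⊂ B(c₋) ∪ B(c₊)}` contains `c`
(elementary API). -/
theorem self_mem_qppBonds_one (c : ZdEdge d) : c ∈ qppBonds 1 c := by
  rw [mem_qppBonds, mem_twoBlocks_iff, mem_twoBlocks_iff, blockMap_one, blockMap_one]
  exact ⟨Or.inl rfl, Or.inr rfl⟩

/-- [cite: Balaban1987RG1, (0.12) p.254][cite: Balaban1985Averaging, Prop.4 p.38] **THE `k`-FOLD (0.12)/(0.11)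
AVERAGE IS LOCAL ON THE `L^k`-CUBES**: `Ū^k(c)` depends on `U` only through `U(b)`, `b ⊂ B^k(c₋) ∪ B^k(c₊)` — the
dependence-domain clause of [B7] Proposition 4 («a function of the variables A_b, b ⊂ B^k(c₋) ∪ B^k(c₊)») for [I]'s
actual average, by induction with the nesting of the index sets (the tree's `B7BlockGeometry.qppBonds_subset_mul`). -/
theorem avgIter012_congr (hL : 0 < L) :
    ∀ (k : ℕ) {U U' : ZdEdge d → 𝔸ˣ} {c : ZdEdge d},
      (∀ b ∈ qppBonds (L ^ k) c, U b = U' b) → avgIter012 L U k c = avgIter012 L U' k c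
  | 0, U, U', c, h => by
      rw [avgIter012_zero, avgIter012_zero]
      exact h c (by rw [pow_zero]; exact self_mem_qppBonds_one c)
  | k + 1, U, U', c, h => by
      rw [avgIter012_succ, avgIter012_succ]
      refine avgBar_congr hL fun b hb => avgIter012_congr hL k fun b' hb' => h b' ?_
      rw [pow_succ]
      have hb2 := (mem_qppBonds L).1 hb
      exact qppBonds_subset_mul (pow_pos hL k) hL hb2.1 hb2.2 hb'

/-- [cite: Balaban1987RG1, (0.12) p.254][cite: Balaban1985Averaging, Prop.4 p.38] the same in restriction form:
two configurations that agree on the bonds inside `B^k(c₋) ∪ B^k(c₊)` have the same `Ū^k(c)`; in particular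
`Ū^k(c)` is a function of the restriction `U|_{B^k(c₋) ∪ B^k(c₊)}`. -/
theorem avgIter012_eq_of_restrict_eq (hL : 0 < L) (k : ℕ) {U U' : ZdEdge d → 𝔸ˣ} {c : ZdEdge d}
    (h : Set.restrict (↑(qppBonds (L ^ k) c) : Set (ZdEdge d)) U = Set.restrict ↑(qppBonds (L ^ k) c) U') :
    avgIter012 L U k c = avgIter012 L U' k c :=
  avgIter012_congr hL k fun b hb => by
    have := congrFun h ⟨b, Finset.mem_coe.2 hb⟩
    simpa only [Set.restrict_apply] using this

end Literature.MathematicalPhysics.QuantumFieldTheory.Balaban1983to89.B12Average012Locality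

end
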